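import Summits.CriticalPhenomena.CardyFormulaZ2.Theorems.CardyBoundaryCoulombGasBoundaryDefectGaussianRS17HeightsExistPart1
import Summits.CriticalPhenomena.CardyFormulaZ2.Theorems.CardyBoundaryCoulombGasBoundaryDefectGaussianRS17HeightsExistPart2
import Summits.CriticalPhenomena.CardyFormulaZ2.Theorems.CardyBoundaryCoulombGasBoundaryDefectGaussianRStubRealisabilityPart30

/-!
# Stub `s17_heightsExist` of line `rainbow-monomials-in-excursion-kernels` — Part 3:
# the correction `H` vanishes outside the cell region, at the ghosts and at the arc vertices
# (crux `BoundaryDefectGaussianR`, stmt-CriticalPhenomena-14132; insertion dictionary D2, T5c)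

Setting of Parts 1–2: `M = ι.model V` (admissible, FLAT at radius `sinkLegs + 4`, radius-`3` CHARTS,
and here also: complement of `V` king-connected and `6`-KINGCHARTS at the first-layer points), a
valid `h₀`, a rainbow `ω ⊆ E`, an arrow assignment `s` (invariant off the cuts, forced at the cuts),
`w = sgn s - sgn (bit h₀)` on `CS = cornerSet M.piece` and the correction

  `H(F) = ∑_{c ∈ CS} w(c) · dartWnd(cornerDart c, F)`     (a function on ALL unit squares `F`).

By Part 2 `w` satisfies the cycle condition, so (Part 1) `H` jumps by `w(c)` across the dart of `c`
and not at all across a side one of whose squares is not a cell (`w ≠ 0` only at tracked corners).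

* `he_ghost_outer_face` (registered as `s17_heightsExist_part3`) — by the `6`-KINGCHART at a ghost,
  one of the four faces at it has no corner in `V` (is not a face-cell);
* `he_H_step`, `he_H_outside` — `H` is constant along chains of edge-adjacent non-cells and vanishes
  far away, hence (**co-hole-freeness of the cell region**, Part 30) `H = 0` at every non-cell that is
  edge-adjacent to a cell;
* `he_H_ghost` — `H = 0` at (the vertex square of) every ghost: no jump towards its outer face;
* `he_H_arc` — `H = 0` at every arc vertex with an outside neighbour `g = a + dir k` (a ghost): the
  spoke `{a, g}` is frozen open, the turn from `(g, k+1)` to `(a, k)` inside the face after the spoke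
  is a frozen turn over the piece, so `w` takes the same value at both corners (`he_transfer`) and the
  two jumps of `H` into the common face cancel; `he_arc_exterior` supplies `k` for arc vertices.
-/

namespace Summit.CriticalPhenomena.CardyFormulaZ2.Cruxes.BoundaryDefectGaussianR.RainbowMonomialsInExcursionKernels

open Finset Literature.Probability.LatticeModels Literature.Probability.LatticeModels.CollarLegModel
open Literature.Probability.Percolation Literature.Probability.LatticeModels.MedialTrail
open Literature.Probability.Percolation.CellComplex

/-! ### A ghost has an outer face -/

/-- **A ghost has a face with no corner in `V`.** By the `6`-KINGCHART at the first-layer point `g`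
(`V` is a closed generalised quadrant or the complement of an open one near `g`), the face at `g`
on the side away from `V` has its four corners outside `V`, so it is not a face-cell. [folklore] -/
theorem he_ghost_outer_face (M : CollarLegModel)
    (hLS : ∀ z : ℤ × ℤ, z ∉ M.V → (∃ v ∈ M.V, max |v.1 - z.1| |v.2 - z.2| ≤ 1) → ∃ σ τ a c : ℤ, |σ| ≤ 1 ∧ |τ| ≤ 1 ∧
      ((∀ v : ℤ × ℤ, max |v.1 - z.1| |v.2 - z.2| ≤ 6 → (v ∈ M.V ↔ 0 ≤ σ * (v.1 - a) ∧ 0 ≤ τ * (v.2 - c))) ∨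
       (∀ v : ℤ × ℤ, max |v.1 - z.1| |v.2 - z.2| ≤ 6 → (v ∈ M.V ↔ 0 < σ * (v.1 - a) ∨ 0 < τ * (v.2 - c)))))
    {g : ℤ × ℤ} (hg : g ∈ M.ghosts) : ∃ k : Fin 4, ofSite (cFace (toSite g, k)) ∉ M.faceCells := by
  obtain ⟨hgV, hlayer⟩ := crr_ghost_layer M hg
  obtain ⟨σ, τ, a, c, hσ, hτ, hch⟩ := hLS g hgV hlayer
  obtain ⟨δ₁, hδ₁⟩ : ∃ δ₁ : ℤ, δ₁ = if σ = 1 then 1 else 0 := ⟨_, rfl⟩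
  obtain ⟨δ₂, hδ₂⟩ : ∃ δ₂ : ℤ, δ₂ = if τ = 1 then 1 else 0 := ⟨_, rfl⟩
  have h01 : (δ₁ = 0 ∨ δ₁ = 1) ∧ (δ₂ = 0 ∨ δ₂ = 1) := by
    constructor
    · rw [hδ₁]; split_ifs <;> simp
    · rw [hδ₂]; split_ifs <;> simp
  have hgnear : max |g.1 - g.1| |g.2 - g.2| ≤ 6 := by simp
  -- the face `(g.1 - δ₁, g.2 - δ₂)` has no corner in `V`
  have hfree : ∀ u ∈ M.V, ¬((g.1 - δ₁, g.2 - δ₂).1 ≤ u.1 ∧ u.1 ≤ (g.1 - δ₁, g.2 - δ₂).1 + 1 ∧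
      (g.1 - δ₁, g.2 - δ₂).2 ≤ u.2 ∧ u.2 ≤ (g.1 - δ₁, g.2 - δ₂).2 + 1) := by
    intro u hu hbox
    simp only at hbox
    have hnear : max |u.1 - g.1| |u.2 - g.2| ≤ 6 := by rw [crr_max_abs_le_iff]; omega
    rcases crr_sign_cases hσ with rfl | rfl | rfl <;> rcases crr_sign_cases hτ with rfl | rfl | rfl <;>
      norm_num at hδ₁ hδ₂ <;> rcases hch with hch | hch <;>
      · have h1 := (hch u hnear).1 hu
        have h2 := mt (hch g hgnear).2 hgV
        omega
  have hnot : (g.1 - δ₁, g.2 - δ₂) ∉ M.faceCells := crr_not_mem_faceCells_of_free M hfree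
  have hfv : (g.1 - δ₁, g.2 - δ₂) ∈ SixVertex.vertexFaces g := by
    obtain ⟨h1 | h1, h2 | h2⟩ := h01 <;> subst h1 <;> subst h2 <;> simp [SixVertex.vertexFaces]
  obtain ⟨k, hk⟩ := dict_exists_corner_of_vertexFaces hfv
  exact ⟨k, by rw [hk]; exact hnot⟩

/-! ### The correction `H` outside the cell region -/

/-- The four elements of `Fin 4` (private copy, as in Parts 41–46). [folklore] -/
private theorem fin4_cases (j : Fin 4) : j = 0 ∨ j = 1 ∨ j = 2 ∨ j = 3 := by fin_cases j <;> simp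

section Model

variable (ι : LegInsertionData) (V : Finset (ℤ × ℤ)) (hadm : ι.IsAdmissible V)
  (hflat : ∀ x ∈ insert ι.sink ι.source, ∃ dvec : ℤ × ℤ,
    (dvec = (1, 0) ∨ dvec = (-1, 0) ∨ dvec = (0, 1) ∨ dvec = (0, -1)) ∧
    ∀ v : ℤ × ℤ, (v.1 - x.1) ^ 2 + (v.2 - x.2) ^ 2 ≤ ((ι.sinkLegs : ℤ) + 4) ^ 2 →
      (v ∈ V ↔ 0 ≤ (v.1 - x.1) * dvec.1 + (v.2 - x.2) * dvec.2))
  (hchart : ∀ u ∈ V, ∀ k : Fin 4, u + dir k ∉ V → ∃ (K : Fin 4) (c₁ c₂ : ℤ),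
    (∀ v : ℤ × ℤ, |v.1 - u.1| ≤ 3 → |v.2 - u.2| ≤ 3 →
      (v ∈ V ↔ c₂ ≤ v.1 * (dir (K + 1)).1 + v.2 * (dir (K + 1)).2)) ∨
    (∀ v : ℤ × ℤ, |v.1 - u.1| ≤ 3 → |v.2 - u.2| ≤ 3 →
      (v ∈ V ↔ c₁ ≤ v.1 * (dir K).1 + v.2 * (dir K).2 ∧
        c₂ ≤ v.1 * (dir (K + 1)).1 + v.2 * (dir (K + 1)).2)) ∨
    (∀ v : ℤ × ℤ, |v.1 - u.1| ≤ 3 → |v.2 - u.2| ≤ 3 →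
      (v ∈ V ↔ c₂ ≤ v.1 * (dir (K + 1)).1 + v.2 * (dir (K + 1)).2 ∨
        v.1 * (dir K).1 + v.2 * (dir K).2 ≤ c₁)))
  (hK : ∀ u ∉ V, ∀ w ∉ V, Relation.ReflTransGen
    (fun b c : ℤ × ℤ => b ∉ V ∧ c ∉ V ∧ max |b.1 - c.1| |b.2 - c.2| ≤ 1) u w)
  (hLS : ∀ z : ℤ × ℤ, z ∉ V → (∃ v ∈ V, max |v.1 - z.1| |v.2 - z.2| ≤ 1) → ∃ σ τ a c : ℤ, |σ| ≤ 1 ∧ |τ| ≤ 1 ∧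
    ((∀ v : ℤ × ℤ, max |v.1 - z.1| |v.2 - z.2| ≤ 6 → (v ∈ V ↔ 0 ≤ σ * (v.1 - a) ∧ 0 ≤ τ * (v.2 - c))) ∨
     (∀ v : ℤ × ℤ, max |v.1 - z.1| |v.2 - z.2| ≤ 6 → (v ∈ V ↔ 0 < σ * (v.1 - a) ∨ 0 < τ * (v.2 - c)))))
  {h₀ : ↥(ι.model V).freeCells → ℤ} (hh₀ : h₀ ∈ (ι.model V).configs)
  {ω : Finset ((ℤ × ℤ) × Bool)} (hω : ω ⊆ (ι.model V).E) (hR : ι.Rainbow V ω)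
  {s : Site 2 × Fin 4 → Bool}
  (hs1 : ∀ c ∈ cornerSet (ι.model V).piece, ¬(ι.model V).IsCut c → s (nextCorner ((ι.model V).cfgOf ω) c) = s c)
  (hs2 : ∀ c ∈ cornerSet (ι.model V).piece, (ι.model V).IsCut c → s c = (ι.model V).bit h₀ c)

include hω hs2 in
/-- Non-zero weights sit on tracked corners: both squares of the dart are cells. [folklore] -/
theorem he_w_support : ∀ c ∈ cornerSet (ι.model V).piece,
    BKW.sgn (s c) - BKW.sgn ((ι.model V).bit h₀ c) ≠ 0 →
      lf (cornerDart c) ∈ (ι.model V).cellRegion ∧ rf (cornerDart c) ∈ (ι.model V).cellRegion := by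
  intro c hc hw
  have hcut : ¬(ι.model V).IsCut c := fun hcut => hw (he_w_cut ι V hs2 hc hcut)
  exact (isTracked_iff_cornerDart _ c).1 (he_tracked_of_not_isCut _ hω hcut).1

include hadm hflat hchart hh₀ hω hR hs1 hs2 in
/-- **`H` is constant across a side with a non-cell**: two edge-adjacent squares (in the coordinates
of `CellBoundary`) that are both outside the cell region carry the same value of `H`. [folklore] -/
theorem he_H_step (x y : Fin 2 → ℤ)
    (hx : x ∉ (ι.model V).cellRegion.image (fun F : ℤ × ℤ => (![F.1, F.2] : Fin 2 → ℤ)))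
    (hxy : CellAdj x y) :
    (∑ c ∈ cornerSet (ι.model V).piece, (BKW.sgn (s c) - BKW.sgn ((ι.model V).bit h₀ c)) * dartWnd (cornerDart c) (x 0, x 1)) =
      ∑ c ∈ cornerSet (ι.model V).piece, (BKW.sgn (s c) - BKW.sgn ((ι.model V).bit h₀ c)) * dartWnd (cornerDart c) (y 0, y 1) := by
  have hdiv := he_div ι V hadm hflat hchart hh₀ hω hR hs1 hs2
  have hU := he_w_support ι V hω hs2
  obtain ⟨j, rfl⟩ := (crr_cellAdj_iff x y).1 hxy
  have ex : x = ![x 0, x 1] := crr_site_eq x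
  rw [ex, crr_mem_image_iff] at hx
  rcases fin4_cases j with rfl | rfl | rfl | rfl
  · have e : ((x + cornerUnit 0) 0, (x + cornerUnit 0) 1) = (x 0 + 1, x 1) :=
      Prod.ext (by simp [cornerUnit]; try ring) (by simp [cornerUnit]; try ring)
    rw [e]
    have := hw_eq_west _ _ hdiv _ hU (x 0 + 1, x 1) (Or.inr (by simpa using hx))
    simpa using this.symm
  · have e : ((x + cornerUnit 1) 0, (x + cornerUnit 1) 1) = (x 0, x 1 + 1) :=
      Prod.ext (by simp [cornerUnit]; try ring) (by simp [cornerUnit]; try ring)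
    rw [e]
    have := hw_eq_south _ _ hdiv _ hU (x 0, x 1 + 1) (Or.inr (by simpa using hx))
    simpa using this.symm
  · have e : ((x + cornerUnit 2) 0, (x + cornerUnit 2) 1) = (x 0 - 1, x 1) :=
      Prod.ext (by simp [cornerUnit]; try ring) (by simp [cornerUnit]; try ring)
    rw [e]
    exact hw_eq_west _ _ hdiv _ hU (x 0, x 1) (Or.inl hx)
  · have e : ((x + cornerUnit 3) 0, (x + cornerUnit 3) 1) = (x 0, x 1 - 1) :=
      Prod.ext (by simp [cornerUnit]; try ring) (by simp [cornerUnit]; try ring)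
    rw [e]
    exact hw_eq_south _ _ hdiv _ hU (x 0, x 1) (Or.inl hx)

include hadm hflat hchart hK hLS hh₀ hω hR hs1 hs2 in
/-- **`H` vanishes at every non-cell edge-adjacent to a cell.** By the co-hole-freeness of the cell
region (Part 30: complement of `V` king-connected, `6`-KINGCHARTS) such a square is joined through
edge-adjacent non-cells to squares arbitrarily far away, where `H = 0` (Part 1); along the chain `H`
is constant (`he_H_step`). [folklore] -/
theorem he_H_outside (O : ℤ × ℤ) (hO : O ∉ (ι.model V).cellRegion)
    (hadj : ∃ P ∈ (ι.model V).cellRegion, CellAdj (![P.1, P.2] : Fin 2 → ℤ) ![O.1, O.2]) :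
    (∑ c ∈ cornerSet (ι.model V).piece, (BKW.sgn (s c) - BKW.sgn ((ι.model V).bit h₀ c)) * dartWnd (cornerDart c) O) = 0 := by
  have hdiv := he_div ι V hadm hflat hchart hh₀ hω hR hs1 hs2
  obtain ⟨B, hB0, hB⟩ := hw_exists_bound (cornerSet (ι.model V).piece)
  obtain ⟨P, hP, hPO⟩ := hadj
  have hO' : (![O.1, O.2] : Fin 2 → ℤ) ∉ (ι.model V).cellRegion.image (fun F : ℤ × ℤ => (![F.1, F.2] : Fin 2 → ℤ)) := by
    rw [crr_mem_image_iff]; exact hO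
  obtain ⟨o', hfar, hchain⟩ := crr_coHoleFree (ι.model V) hK hLS _ hO'
    ⟨![P.1, P.2], by rw [crr_mem_image_iff]; exact hP, hPO⟩ (2 * B + 2)
  -- along the chain `H` is constant
  have hconst : ∀ b : Fin 2 → ℤ, Relation.ReflTransGen
      (fun x y => x ∉ (ι.model V).cellRegion.image (fun F : ℤ × ℤ => (![F.1, F.2] : Fin 2 → ℤ)) ∧
        y ∉ (ι.model V).cellRegion.image (fun F : ℤ × ℤ => (![F.1, F.2] : Fin 2 → ℤ)) ∧ CellAdj x y) ![O.1, O.2] b →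
      (∑ c ∈ cornerSet (ι.model V).piece, (BKW.sgn (s c) - BKW.sgn ((ι.model V).bit h₀ c)) * dartWnd (cornerDart c) O) =
        ∑ c ∈ cornerSet (ι.model V).piece, (BKW.sgn (s c) - BKW.sgn ((ι.model V).bit h₀ c)) * dartWnd (cornerDart c) (b 0, b 1) := by
    intro b hb
    induction hb with
    | refl => simp
    | tail _ hxy ih => rw [ih]; exact he_H_step ι V hadm hflat hchart hh₀ hω hR hs1 hs2 _ _ hxy.1 hxy.2.2
  rw [hconst o' hchain]
  -- far away `H` vanishes
  apply hw_eq_zero_of_far _ _ hdiv hB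
  by_contra hnot
  push Not at hnot
  have hn := Complex.norm_le_abs_re_add_abs_im (ctr o')
  rw [ctr_re, ctr_im] at hn
  have h0 : |((o' 0 : ℤ) : ℝ)| ≤ B := by exact_mod_cast hnot.1
  have h1 : |((o' 1 : ℤ) : ℝ)| ≤ B := by exact_mod_cast hnot.2
  have a0 : |((o' 0 : ℤ) : ℝ) + 1 / 2| ≤ |((o' 0 : ℤ) : ℝ)| + 1 / 2 :=
    (abs_add_le _ _).trans (by rw [abs_of_pos (by norm_num : (0 : ℝ) < 1 / 2)])
  have a1 : |((o' 1 : ℤ) : ℝ) + 1 / 2| ≤ |((o' 1 : ℤ) : ℝ)| + 1 / 2 :=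
    (abs_add_le _ _).trans (by rw [abs_of_pos (by norm_num : (0 : ℝ) < 1 / 2)])
  linarith

include hadm hflat hchart hK hLS hh₀ hω hR hs1 hs2 in
/-- **`H` vanishes at every ghost**: towards its outer face (`he_ghost_outer_face`) the corner is
untracked, hence a cut with `w = 0`, so `H` does not jump, and the outer face is a non-cell
edge-adjacent to the ghost's square. [folklore] -/
theorem he_H_ghost {g : ℤ × ℤ} (hg : g ∈ (ι.model V).ghosts) :
    (∑ c ∈ cornerSet (ι.model V).piece, (BKW.sgn (s c) - BKW.sgn ((ι.model V).bit h₀ c)) *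
      dartWnd (cornerDart c) (vcell (toSite g))) = 0 := by
  have hdiv := he_div ι V hadm hflat hchart hh₀ hω hR hs1 hs2
  obtain ⟨k, hk⟩ := he_ghost_outer_face (ι.model V) hLS hg
  have hgc : g ∈ (ι.model V).vertexCells := mem_union_right _ hg
  have hc : (toSite g, k) ∈ cornerSet (ι.model V).piece := by
    rw [mem_cornerSet, dict_mem_piece_iff, ofSite_toSite]; exact hgc
  have hcut : (ι.model V).IsCut (toSite g, k) := by
    by_contra hcut
    exact hk (by simpa using (he_tracked_of_not_isCut (ι.model V) hω hcut).1.2)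
  have hj := hw_jump_corner _ _ hdiv (toSite g, k)
  rw [if_pos hc, he_w_cut ι V hs2 hc hcut, sub_eq_zero] at hj
  simp only at hj
  rw [hj]
  -- the outer face is a non-cell adjacent to the ghost square
  refine he_H_outside ι V hadm hflat hchart hK hLS hh₀ hω hR hs1 hs2 _ ?_ ⟨vcell (toSite g), ?_, ?_⟩
  · rw [mem_cellRegion_fcell_iff]; exact hk
  · rw [mem_cellRegion_vcell_iff, ofSite_toSite]; exact hgc
  · have hbox := perCfg_ofSite_cFace_mem_vertexFaces (toSite g, k)
    rw [ofSite_toSite] at hbox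
    simp only [SixVertex.vertexFaces, mem_insert, mem_singleton] at hbox
    have h := (crr_cellAdj_of_corner (x := g) (f := ofSite (cFace (toSite g, k))) (by
      rcases hbox with h | h | h | h <;> rw [h] <;> simp)).1
    have e1 : vcell (toSite g) = (g.1 + g.2 - 1, g.2 - g.1) := by simp [vcell, toSite]
    have e2 : fcell (cFace (toSite g, k)) = ((ofSite (cFace (toSite g, k))).1 + (ofSite (cFace (toSite g, k))).2,
        (ofSite (cFace (toSite g, k))).2 - (ofSite (cFace (toSite g, k))).1) := by simp [fcell, ofSite]
    rw [e1, e2]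
    exact h

include hadm hflat hchart hK hLS hh₀ hω hR hs1 hs2 in
/-- **`H` vanishes at every arc vertex with an outside neighbour** `g = a + dir k`: `g` is a ghost,
the spoke `{a, g}` is frozen open, so the corner `(g, k+1)` turns to `(a, k)` inside their common
face; this frozen turn over the piece preserves `w` (`he_transfer`), hence the jumps of `H` from the
two vertex squares into the common face square agree, and `H(a) = H(g) = 0`. [cite: BaxterKellandWu1976, §4] -/
theorem he_H_arc {a : ℤ × ℤ} (ha : a ∈ (ι.model V).arcVerts) (k : Fin 4) (hk : a + dir k ∉ V) :
    (∑ c ∈ cornerSet (ι.model V).piece, (BKW.sgn (s c) - BKW.sgn ((ι.model V).bit h₀ c)) *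
      dartWnd (cornerDart c) (vcell (toSite a))) = 0 := by
  have hdiv := he_div ι V hadm hflat hchart hh₀ hω hR hs1 hs2
  have haV : a ∈ V := (mem_inter.1 ha).2
  set g := a + dir k with hgdef
  have hg : g ∈ (ι.model V).ghosts :=
    mem_sdiff.2 ⟨mem_union_left _ (mem_biUnion.2 ⟨a, ha, mem_neighbours_iff.2 ⟨k, rfl⟩⟩), hk⟩
  have hgc : g ∈ (ι.model V).vertexCells := mem_union_right _ hg
  -- the spoke is frozen open, and `(g, k+1)` turns to `(a, k)`
  obtain ⟨e, hce, hend⟩ := se_corner_edge g (k + 1)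
  have hga : g + dir (k + 1 + 1) = a := by
    rw [hgdef, add_assoc, show k + 1 + 1 = k + 2 from fin4_add_one_add_one k, tp_dir_add_two]; abel
  rw [hga] at hend
  have hopen : e ∈ (ι.model V).openEdges := by
    rw [openEdges, mem_filter, frozenEdges, mem_sdiff]
    refine ⟨⟨?_, ?_⟩, ?_⟩
    · rw [SixVertex.mem_edges_iff]
      rcases hend with ⟨h1, -⟩ | ⟨h1, -⟩
      · exact Or.inl (h1 ▸ hgc)
      · exact Or.inl (h1 ▸ mem_union_left _ haV)
    · rw [mem_E_iff]
      rcases hend with ⟨h1, -⟩ | ⟨-, h2⟩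
      · exact fun h => hk (h1 ▸ h.2.1)
      · exact fun h => hk (h2 ▸ h.2.2)
    · rcases hend with ⟨h1, h2⟩ | ⟨h1, h2⟩
      · exact Or.inr (Or.inl ⟨h2 ▸ ha, h1 ▸ hg⟩)
      · exact Or.inl ⟨h1 ▸ ha, h2 ▸ hg⟩
  have hm : cTgt (toSite g, k + 1) ∈ (ι.model V).cfgOf ∅ :=
    (se_cTgt_mem_cfgOf_iff (ι.model V) ∅ hce).2 (Or.inr hopen)
  have hnext : nextCorner ((ι.model V).cfgOf ∅) (toSite g, k + 1) = (toSite a, k) := by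
    rw [nextCorner_of_mem hm]
    simp only
    rw [← se_toSite_add_dir, hga, fin4_add_one_add_three]
  have hcg : (toSite g, k + 1) ∈ cornerSet (ι.model V).piece := by
    rw [mem_cornerSet, dict_mem_piece_iff, ofSite_toSite]; exact hgc
  have hca : (toSite a, k) ∈ cornerSet (ι.model V).piece := by
    rw [mem_cornerSet, dict_mem_piece_iff, ofSite_toSite]; exact mem_union_left _ haV
  have hl : ¬(ι.model V).TargetsLive (toSite g, k + 1) := fun h => hk ((se_targetsLive_iff _ g (k + 1)).1 h).1
  have htr := he_transfer ι V hadm hflat hchart hh₀ hω hR hs1 hs2 hcg hl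
  rw [hnext] at htr
  -- the two jumps into the common face
  have hja := hw_jump_corner _ _ hdiv (toSite a, k)
  have hjg := hw_jump_corner _ _ hdiv (toSite g, k + 1)
  rw [if_pos hca] at hja
  rw [if_pos hcg] at hjg
  have hface : cFace (toSite a, k) = cFace (toSite g, k + 1) := by
    rw [← hnext]; exact cFace_nextCorner_of_mem hm
  rw [hface] at hja
  simp only at hja hjg
  have hH := he_H_ghost ι V hadm hflat hchart hK hLS hh₀ hω hR hs1 hs2 hg
  linarith

include hadm in
/-- An arc vertex of the jump collar has an outside neighbour (it is the vertex of a dart of the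
boundary walk, and walk darts are exterior). [folklore] -/
theorem he_arc_exterior {a : ℤ × ℤ} (ha : a ∈ (ι.collar V).arc) : ∃ k : Fin 4, a + dir k ∉ V := by
  obtain ⟨d₀, h0, -⟩ := s3_of_admissible ι V hadm
  obtain ⟨t, ht, -, hta⟩ := (mem_collar_arc_iff ι V h0
    (st := fun t => List.foldl (fun s d => s.step (ι.startAt V d)) ι.init ((cycle V d₀).take t)) (fun _ => rfl)).1 ha
  have hex := cycle_getElem_exterior ι V hadm h0 ht
  rw [hta] at hex
  exact ⟨_, hex.2⟩

end Model

/-- **Sub-goal `s17_heightsExist_part3`** (registered on stmt-CriticalPhenomena-14132; T5c, Part 3):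
under `6`-KINGCHARTS at the first-layer points of `V`, every ghost of a collar leg model on `V` has,
among the four faces at it, one that is not a face-cell (no corner in `V`) — the exit through which
the correction `H` of a ghost square is read off outside the cell region. [folklore] -/
theorem s17_heightsExist_part3 : ∀ (M : Literature.Probability.LatticeModels.CollarLegModel), (∀ z : ℤ × ℤ, z ∉ M.V → (∃ v ∈ M.V, max |v.1 - z.1| |v.2 - z.2| ≤ 1) → ∃ σ τ a c : ℤ, |σ| ≤ 1 ∧ |τ| ≤ 1 ∧ ((∀ v : ℤ × ℤ, max |v.1 - z.1| |v.2 - z.2| ≤ 6 → (v ∈ M.V ↔ 0 ≤ σ * (v.1 - a) ∧ 0 ≤ τ * (v.2 - c))) ∨ (∀ v : ℤ × ℤ, max |v.1 - z.1| |v.2 - z.2| ≤ 6 → (v ∈ M.V ↔ 0 < σ * (v.1 - a) ∨ 0 < τ * (v.2 - c))))) → ∀ g ∈ M.ghosts, ∃ k : Fin 4, Literature.Probability.LatticeModels.CollarLegModel.ofSite (Literature.Probability.LatticeModels.cFace (Literature.Probability.LatticeModels.CollarLegModel.toSite g, k)) ∉ M.faceCells :=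
  fun M hLS _ hg => he_ghost_outer_face M hLS hg

end Summit.CriticalPhenomena.CardyFormulaZ2.Cruxes.BoundaryDefectGaussianR.RainbowMonomialsInExcursionKernels
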